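import Summits.HodgeConjecture.HodgeConjecture.Theorems.TorelliForSymmetriesReflectionsDecide
import Summits.HodgeConjecture.HodgeConjecture.Theorems.TorelliForSymmetriesInvolutionsOfMiddle
import Literature.AlgebraicGeometry.Motives.SegreEmbedding
import HarnessLib

/-!
# Crux `MiddleInvolutions` (stmt-HodgeConjecture-14418), line `birth` — the crux from its one open stub
# `stub_middleReflections` alone (stub 2 `stub_reflectionsDecide` = the proved item `ReflectionsDecide`)

Route `HodgeConjecture/TorelliForSymmetries`, crux `MiddleInvolutions` (rank 5, the catch-all complementary sector);
registered skeleton `Cruxes/MiddleInvolutions/Lines/birth.lean` (`MiddleInvolutions_of : S₁ → ReflectionsDecide →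
MiddleInvolutions`: double `Y ↦ Y × Y`, polarize the middle cohomology of the square, reflections in Hodge classes of the
square (S₁) feed the reflection lemma at `(Y × Y, p = n + n)`). Its stub 2 is the route's support item `ReflectionsDecide`
(stmt-HodgeConjecture-11028) BY NAME, PROVED in the tree (`Theorems.torelliForSymmetries_reflectionsDecide_proof`). This file
re-runs the composition with that stub discharged (a verbatim restatement `stub_reflectionsDecide := …_proof` is refused by
the gate as `dedup.landed`; the lead closes the stub by `exact Theorems.torelliForSymmetries_reflectionsDecide_proof`):

* `middleInvolutions_of_middleReflections : S₁ → Theses.TorelliForSymmetries.MiddleInvolutions` — the crux BY NAME from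
  its one OPEN stub (reflections `s_v` in Hodge classes `v` of the middle cohomology of an even-dimensional smooth projective
  `Y` are induced by rational algebraic classes on `Y × Y`; HC-complete), hypothesis written VERBATIM as the registered
  signature of `stub_middleReflections`.

Nothing here is a case of the Hodge conjecture; no definition, no named fact, no sorry.
References: [Kleiman1968AlgebraicCycles] §1.3; [VoisinHodgeI2002] §7.1.2 Def. 7.7, §11.3.3 Lemma 11.41.
-/

noncomputable section

-- every declaration of this problem lives in `Summit.HodgeConjecture.HodgeConjecture.…` (summit = sub-problem)
set_option linter.dupNamespace false

open CategoryTheory MonoidalCategory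
open Literature.AlgebraicGeometry.Motives
open scoped TensorProduct
open Summit.HodgeConjecture.HodgeConjecture.Theses.TorelliForSymmetries

namespace Summit.HodgeConjecture.HodgeConjecture.Theorems.MiddleInvolutions

/-- **`MiddleInvolutions` from its one open stub** (the skeleton's `MiddleInvolutions_of` with `stub_reflectionsDecide`
replaced by the landed `torelliForSymmetries_reflectionsDecide_proof`): for `φ` an endomorphism of the `B`-Hodge structure `H^{2n}_B(Y)`, the Künneth–Hodge clause gives a Hodge class
`u ∈ Hdg^{n+n}_B(Y × Y)` inducing `φ`; `Y × Y` is smooth projective of dimension `(n+n)+(n+n)` (Segre); with a polarization of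
`H^{2(n+n)}_B(Y × Y)`, the hypothesis at `Y × Y` is exactly what the reflection lemma needs at `(Y × Y, p = n + n)`, whence
`B.HodgeConjectureFor hYY (n+n)` and `u ∈ A^{n+n}(Y × Y) ⊗ ℚ`. [cite: VoisinHodgeI2002, §11.3.3 Lemma 11.41]
[cite: Kleiman1968AlgebraicCycles, §1.3] -/
theorem middleInvolutions_of_middleReflections
    (hR : ∀ B : BettiHodgeData ℂ, B.IsComparisonCompatible →
      (∀ ⦃n : ℕ⦄ ⦃X : SchemeOver ℂ⦄ (hX : IsSmoothProjective n X)
          (hXX : IsSmoothProjective (n + n) (X ⊗ X)) (i j' : ℕ) (hj : i + j' = 2 * n)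
          (φ : HodgeStructure.Hom (B.hodge hX i) (B.hodge hX i)),
          ∃ u ∈ (B.hodge hXX (2 * n)).hodgeClasses (n : ℤ),
            B.W.IsInducedBy n n u φ.toLinearMap hj (show i + 2 * n + j' = 2 * (n + n) by omega)) →
      ∀ ⦃n : ℕ⦄ ⦃Y : SchemeOver ℂ⦄ (hY : IsSmoothProjective (n + n) Y)
        (P : (B.hodge hY (2 * n)).Polarization),
        ∀ v ∈ (B.hodge hY (2 * n)).hodgeClasses (n : ℤ),
          ∀ (j' : ℕ) (hj : 2 * n + j' = 2 * (n + n)),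
            ∃ u ∈ B.W.ratAlgebraicClasses (Y ⊗ Y) (n + n),
              B.W.IsInducedBy (n + n) (n + n) u
                (LinearMap.id - (P.form.flip v).smulRight ((2 / P.form v v) • v) :
                  B.W.obj Y (2 * n) →ₗ[ℚ] B.W.obj Y (2 * n))
                hj (show 2 * n + 2 * (n + n) + j' = 2 * ((n + n) + (n + n)) by omega)) :
    Summit.HodgeConjecture.HodgeConjecture.Theses.TorelliForSymmetries.MiddleInvolutions := by
  unfold Summit.HodgeConjecture.HodgeConjecture.Theses.TorelliForSymmetries.MiddleInvolutions
  intro B hB K n Y hY φ _hφ j' hj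
  -- the square `Y × Y` is smooth projective of dimension `(n+n)+(n+n)` (Segre)
  have hYY : IsSmoothProjective ((n + n) + (n + n)) (Y ⊗ Y) := IsSmoothProjective.tensor_holds hY hY
  -- Künneth–Hodge clause: a middle-degree Hodge class on `Y × Y` inducing `φ`
  obtain ⟨u, hu, hind⟩ := K hY hYY (2 * n) j' hj φ
  -- a polarization of the middle cohomology of the square
  obtain ⟨P⟩ := B.polarizable hYY (2 * (n + n))
  -- HC for `(Y × Y, n+n)`: the reflection lemma (PROVED) fed with the hypothesis at `Y × Y`
  have hHC : B.HodgeConjectureFor hYY (n + n) :=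
    torelliForSymmetries_reflectionsDecide_proof B hYY (n + n) P (fun v hv j'' hj'' ↦ hR B hB K hYY P v hv j'' hj'')
  -- so the Hodge class `u` is a rational algebraic class
  have hu' : u ∈ B.W.algebraicClasses (Y ⊗ Y) (n + n) := (B.hodgeConjectureFor_iff hYY (n + n)).1 hHC hu
  exact ⟨u, mem_ratAlgebraicClasses_of_mem_algebraicClasses B.W (Y ⊗ Y) (n + n) hu', hind⟩

end Summit.HodgeConjecture.HodgeConjecture.Theorems.MiddleInvolutions

end
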